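import Literature.MathematicalPhysics.QuantumFieldTheory.Balaban1983to89.B9SectCDiffCutModelToy13

/-!
# `Balaban1983to89.B9SectCDiffCutModelToy14` — THE SMOOTH-CUTOFF DATUM: the first `TwoSeq` inhabitant with `∂ ≠ 0`
AND NON-TRIVIAL INTERTWINERS `χ = diag(h₄)`, `ψ = cutX(h₄ ∘ x_S)`, its complete `CutModel` (all seven defect slots
and the Leibniz block GENUINE, `θ = O(M⁻¹)`), and THEOREM D's conclusion for it on the decaying frame: the zone
localisation of the commutator `[h, Q′GQ′*]` (census `b2b-balaban-r1/SectC-inst-census.md` §6 (a⁵) ff.; note N20)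

B9 = T. Bałaban, *Propagators for lattice gauge theories in a background field*, Commun. Math. Phys. **99**, 389–434
(1985) [Balaban1985BackgroundPropagators].

CITATION HEADER (lean-in-tree rule 2026-08-18).  Cell `pub-balaban`, unit `b2b-balaban-r1-g20` (READER GROUP A,
lineage r1, gen 20), journal claim `SECTC-DIFF-CUTMODEL-TOY14` (successor of the same lineage's `…Toy13` under claim
`SECTC-DIFF-CUTMODEL-TOY13`).  Source: doi:10.1007/bf01240355, held `paper:balaban1985-cmp99-background-propagators`,
journal page = PDF page + 388.  This unit re-read NO page and introduces NO quotation: the printed shapes used here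
are the cut-model hypothesis structure `CutModel` (the cutoff facts and the h-free records typed from (3.102), p. 414
[PDF 26], and the one-sided forms of (3.100), p. 413 [PDF 25] — both quoted VERBATIM in the headers of
`…B9SectCDiffCutModel` / `…B9SectCDiffEstimate`; the p. 414 sentence *"O(M⁻¹) … on a proper scale"* is quoted in
`…B9SectCDiffAssembly`'s `LDat` docstring), the 40-field hypothesis record `EstHyp` of THEOREM D (Theorem 3.1
(3.42), p. 397 [PDF 9]) and its conclusion `EstHyp.dT_entry` (the typed (3.97), p. 412 [PDF 24]); the present
declarations point to those quotations BY NAME only.  Tree inputs (by name): `B9SectCDiff.{tdef, tdef_def, tdef_add,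
tdef_smul, tdef_one, cutX}`, `B9SectCDiffEstimate.{Frame, Frame.Valid, BlkMaj, BlkMaj.neg, WDec, RowZone, OpDec,
OpZon, EstHyp, EstHyp.dT_entry}`, `B9SectCDiffDict.{opZon_mono, opZon_add}`, `B9SectCDiffAssembly.{MOne, MTwo,
LDat, assemble}`, `B9SectCDiffExpansion.{TwoSeq, TwoSeq.dT}`, `B9SectCDiffCutModel.{OpConst, OpLoc, CutModel,
CutModel.theta, CutModel.theta_nonneg, CutModel.toLDat, cutX_id_id}`, `B9SectCDiffCutModelToy.{lineFrame, dE, bdist,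
bdist_self, bdist_isPseudoDist, rampZone, rampZone_nonempty, Qp, Qp_rowsum, xS, dE_xS_of_fst_eq, opLoc_Qp}`,
`B9SectCDiffCutModelToy2.{Qpt, dE_comm, locQp1}`, `B9SectCDiffCutModelToy3.{toyFrame, toyFrame_valid, opLoc_toy,
opLoc_zero, opDec_Qpt, opDec_of_rowsum}`, `B9SectCDiffCutModelToy4.{ι, ι_inj, Sh, Sh_apply, Dfw, Dbw, fd, bfd, sd,
Th, Xi, El, Sh_mul_transpose, Th_mul_El, Xi_eq, D_mul_dDt, dDDt_eq, leibniz_affine, bdist_le_one_of_succ, opLoc_Dfw,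
opLoc_Dbw, opZon_local_toy, abs_fd_le, zone_of_fd_ne_zero, zone_of_bfd_ne_zero, opZon_Th, h4, h4_modulus, h4_zone,
abs_sd_h4_le, thetaL, thetaL_nonneg, lt_of_hIM, h4_zLm₁, h4_zLm₀}`, `B9SectCDiffCutModelToy5.Gr`,
`B9SectCDiffCutModelToy6.E2`, `B9SectCDiffCutModelToy7.E2_inv_opDec_num`, `B9SectCDiffCutModelToy8.{Lam, Gtoy}`,
`B9SectCDiffCutModelToy9.{opDec_toy_mono, Gtoy_opDec_num, Gr_opDec_num, DGr_opDec_num}`,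
`B9SectCDiffCutModelToy10.{Xdiag, mOne_of_seq1, DbwGtoy_opDec_num, bundle_consts}`, `B9SectCDiffCutModelToy13.{Kg,
Kg_nonneg, Kg_u_le, toyFrameD, toyFrameD_valid, toyFrameD_σ, toyFrameD_profile₁, mOne_toyD, mTwo_toyD, ldatToyD}`
(and the field simp lemmas of `toyFrameD`); Mathlib otherwise.  Cell rows: GAPS C-r1g13-1 (the cut model),
C-r1g14-1 … C-r1g19-1 (the toys 1–13), this module's row C-r1g20-1; census §6 (a⁵) / notes N10–N20.  No
`HarnessLib` fact, no named-fact `Prop`, no `instance`, no new predicate; no `sorry`.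

## WHAT THIS MODULE DOES

Up to Toy13 the cell's THEOREM D pipeline (expansion → estimate → assembly) was run on data whose intertwiners are
TRIVIAL (`χ = ψ = 1`: Toy10's `Xdiag`, Toy11's `Xpot`, Toy12's `Xzone`/`Xcut`), so the seven defect slots of `(L)`
and the Leibniz block were zero and the localisation was carried by the support of a potential; and the one datum
with a genuine cutoff (Toy3's `toyCut`, ramp cutoff `hcut`) has `∂ = 0`, `G = C = G′ = 1`.  This module closes the
gap between the two: the genuine `∂ ≠ 0` operators of Toy10 WITH the `C¹` cutoff `h₄` of Toy4 as intertwiner.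

* §1 **`𝒵(k, θ)` IS CLOSED UNDER NEGATION** (`opZon_neg`, generic; the majorant is unchanged, `BlkMaj.neg`).
* §2 **ONE-SIDED LEIBNIZ IDENTITIES WITH `∂*` ON THE RIGHT** (exact, every cutoff `h`): `Θ_h·∂ = −(Θ_hS)·∂*`
  (`Th_mul_Dfw`), **`∂·𝔇(∂*) = −Θ_h·∂* + Ξ_h·Sᵀ`** (`D_mul_dDt_bw`, the `hM` shape with `Dv = ∂*`) and
  **`𝔇(∂∂*) = −(Θ_h + Θ_hS)·∂* + Ξ_h·Sᵀ`** (`dDDt_eq_bw`, the `hΛ` shape with `Dv = ∂*`); both sides of either are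
  `Θ_h − SᵀΘ_h`.  WHY `∇ := ∂*` and not Toy4's `∇ := ∂`: the slot `MTwo.mDvG : ∇·G₂ ∈ 𝒟(0, 1, c)` must be inhabited,
  and for the toy Green's function `Gtoy` (Dirichlet at the left end through the averaging constraint, Neumann at the
  right end) `∂*·Gtoy ∈ 𝒟(0, 1, 3·10¹⁰/a)` is Toy10's `DbwGtoy_opDec_num`, whereas the last row of `∂·Gtoy` is
  `−Gtoy(L, ·)`, of weighted size `O(B²/a²)`, not `O(B/a)`.
* §3 **THE ZONE CLASSES `Θ_hS ∈ 𝒵(−1, ω₀e^{δ₀})`, `Ξ_hSᵀ ∈ 𝒵(−2, ω₁e^{δ₀})`** (one entry per row at the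
  successor / predecessor, Toy4's local-operator engine `opZon_local_toy`), and the five coefficient operators of
  the cutoff `h₄` — `−(Θ + ΘS)`, `−Θ`, `ΞSᵀ`, `Θ + SᵀΘ`, `Ξ` — in `𝒵(−1, θ_H)` / `𝒵(−2, θ_H)` at the ONE constant
  **`thetaH M δ₀ = (3/2)(1/M)(1 + e^{δ₀}) + (6/M²)e^{δ₀}`** (`= O(M⁻¹)`, uniform in `B`, `n`, `I₀`).
* §4 **THE h-FREE RECORD OF `Q′*`** in the `CutModel.lQt` / `lQ't` shape with all coarse elements as window
  (`opLoc_Qpt`: range / locality `≤ B`, singleton column blocks, row sums `≤ 1·e^{−δ₀ρ}`) and its far-column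
  locality `locQpt2`.
* §5 **THE SMOOTH-CUTOFF DATUM `Xh n B M I₀ a ha haB`**: Toy10's `Xdiag` (∂ = `Dfw`, ∂* = `Dbw`, Λ = `Lam(μ)`,
  Λ′ = μ·1, Q = Q′ = `Qp`, Q* = Q′* = `Qpt`, A = A′ = 0, G′ = `Gr(μ)`, C = `E₂(μ)⁻¹`, G = `Gtoy(μ, μ)`, `μ = (a/B)²`,
  `2²⁰ ≤ a ≤ B`) for BOTH sequences, with the intertwiners **`χs = χb = diag(h₄)`** on the fine carrier and
  **`ψS = ψB = cutX id id (h₄ ∘ x_S)`** (the cutoff read at the block positions `x_S(I) = (I, 0)`) on the coarse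
  carriers; and its COMPLETE CUT MODEL **`cutXh`**: all 76 fields of `CutModel` over the toy frame of the ramp zone
  `rampZone n M I₀` — `h := h₄`, radius `ℓ ≡ B`, `ω₀ = (3/2)(1/M)` (`h4_modulus`, `h4_zone`), positions `id` / `x_S`,
  identity windows (the far facts are vacuous, the agreement facts are `rfl` since the sequences coincide), the SEVEN
  h-free records ALL NON-ZERO except `A = 0` (`opLoc_Qp`, `opLoc_Qpt`, `opLoc_Dfw`, `opLoc_Dbw`), the Leibniz block
  of §2–§3 with `Dv = ∂*` and `θL = thetaH`.  Hence **`ldatXh := cutXh.toLDat`**: the bundle `(L)` of THEOREM D's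
  hypothesis record at **`θ = cutXh.theta = thetaX M δ₀ = (15/2)(1/M)(1 + e^{δ₀}) + (6/M²)e^{δ₀} ≤ 48/M`**
  (`cutXh_theta`, `thetaX_le`) — every one of the seven defect classes `𝔇(Q), 𝔇(Q*), 𝔇(∂), 𝔇(∂*), 𝔇(A), 𝔇(Q′),
  𝔇(Q′*)` produced by the cell's geometric zone dictionary `opZon_of_geom` from a genuine record and a genuine cutoff,
  and all three one-sided forms `hΛ / hM / hA` with non-zero coefficient operators.
* §6 **THE `(M)` BUNDLES** `mOne_Xh`, `mTwo_Xh` at `c = 3a⁴` (Toy10's `mOne_of_seq1` and the nine slots of `MTwo`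
  with `mDvG := DbwGtoy_opDec_num`).
* §7 **THEOREM D FOR THE SMOOTH-CUTOFF DATUM ON THE DECAYING FRAME**: `estHypXhD := assemble …` (Toy13's transports
  `mOne_toyD`, `mTwo_toyD`, `ldatToyD`, the volume-free profile), and the headline **`XhD_dT_entry`**:
  `|𝔇(T)(I, J)| ≤ 22·θ_X·(3a⁴·1·Kg(δ₀/40))¹⁵·B²·exp(−(δ₀/4)·(|I−J| + β(I) + β(J)))`, `β = zoneDepth` to the ramp
  zone, `θ_X = thetaX M δ₀ = O(M⁻¹)`; since the two sequences coincide, `𝔇(T) = diag(h₄∘x_S)·T − T·diag(h₄∘x_S)` is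
  the COMMUTATOR of the block cutoff with the coarse operator `T = Q′·Gtoy·Q′*` (`Xh_dT_apply`:
  `𝔇(T)(I, J) = (h₄(x_S I) − h₄(x_S J))·T(I, J)`), and the headline reads (`XhD_comm_entry`): the commutator
  `[h, Q′GQ′*]` is `O(M⁻¹)` — the printed *"[Δ′, h] gives the factor O(M⁻¹)"* mechanism, here certified end-to-end
  through the cell's expansion (1.12)-shape, the seven-slot zone dictionary and the fifteen-fold assembly — with a
  volume-free constant and exponential decay in the block distance and in the depths of both blocks relative to the
  ramp zone (outside which `h₄` is locally constant and every defect row vanishes); the explicit form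
  **`XhD_dT_entry_explicit`**: `… ≤ 22·(48/M)·(243a⁴/δ₀)¹⁵·B²·exp(−(δ₀/4)(…))` (`thetaX_le`, `const3_pow_le`).

HONEST CAVEATS.  (1) THE TWO SEQUENCES ARE EQUAL (`Xh_T₁_eq_T₂`): the "difference of the two minimal propagators"
content of (3.97) degenerates to a commutator estimate; what is certified with content is the LOCALISATION
MECHANISM of pp. 413–414 (cutoff defects of order `−1`/`−2` on the proper scale, supported on the zone, with
`O(M⁻¹)` constants) on genuine `∂ ≠ 0` operators, not a comparison of two different background fields — a datum
with `χ ≠ 1` AND two different sequences (e.g. Toy12's zone potential added to sequence 2) is the next step and is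
NOT done here.  (2) The left side is not certified non-zero (for `I, J` both deep inside or both outside the ramp
it IS zero, consistently with the depth factors).  (3) The constant `22·θ_X·(3a⁴·Kg(δ₀/40))¹⁵ ≤ 22·(48/M)·
(243a⁴/δ₀)¹⁵` is ASTRONOMICAL in `a ≥ 2²⁰` (the cell's crude monomial bookkeeping), small only through `1/M`; the
rate `δ₀/4` is the cell's generic output rate.  (4) `∇ := ∂*` is forced by the Dirichlet/Neumann asymmetry of the
toy Green's function (§2), not by the text; in `d = 1` there are no genuine 2-tensors and `Dv` is bookkeeping for the
one-sided forms.  (5) One-dimensional TOY (blocks `Fin n`, sites = bonds `Fin n × Fin B`, one level, constant proper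
scale `B`, windows = everything) — NOT summit progress; nothing here bears on B9's Theorems 3.1–3.3 for the lattice
gauge-field operators.  Value = kernel certificate that EVERY hypothesis slot of the cell's THEOREM D record
(`MOne` 7 + `MTwo` 9 + `LDat` 16 fields) is SIMULTANEOUSLY inhabited by genuine finite-volume operators with `∂ ≠ 0`
and a genuine smooth cutoff, with all constants independent of the volume and of the block size except through the
printed powers of the proper scale.
-/

namespace Literature.MathematicalPhysics.QuantumFieldTheory.Balaban1983to89.B9SectCDiffCutModelToy14

open Finset Real
open B4Sect5Torus (IsPseudoDist)
open B6DomainChange (IsDepth Profile)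
open B6DomainMajorant (zoneDepth isDepth_zoneDepth)
open B9SectCDiffEstimate
open B9SectCDiffAssembly
open B9SectCDiffExpansion (TwoSeq)
open B9SectCDiffCutModel
open B9SectCDiffCutModelToy
open B9SectCDiffCutModelToy2
open B9SectCDiffCutModelToy3
open B9SectCDiffCutModelToy4
open B9SectCDiffCutModelToy5
open B9SectCDiffCutModelToy6
open B9SectCDiffCutModelToy7
open B9SectCDiffCutModelToy8
open B9SectCDiffCutModelToy9
open B9SectCDiffCutModelToy10
open B9SectCDiffCutModelToy11
open B9SectCDiffCutModelToy12
open B9SectCDiffCutModelToy13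
open B9SectCDiff (tdef cutX)

noncomputable section

/-! ## §1 The zone class is closed under negation -/

section Neg

/-- **`Z ∈ 𝒵(k, θ) ⇒ −Z ∈ 𝒵(k, θ)`** (same majorant — `BlkMaj.neg` —, same weighted decay, same zone rows).
[folklore] -/
theorem opZon_neg {S u v U V : Type*} [Fintype v] [DecidableEq V] {F : Frame S} {bu : u → U} {bv : v → V}
    {pU : U → S} {pV : V → S} {k : ℤ} {θ : ℝ} {Z : Matrix u v ℝ} (hZ : OpZon F bu bv pU pV k θ Z) :
    OpZon F bu bv pU pV k θ (-Z) := by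
  obtain ⟨K, hK, hW, hR⟩ := hZ
  exact ⟨K, hK.neg, hW, hR⟩

end Neg

/-! ## §2 One-sided Leibniz identities with `∂*` on the right (exact, every cutoff `h`) -/

section Algebra

variable {n B : ℕ} (h : Fin n × Fin B → ℝ)

/-- **`Θ_h·∂ = −(Θ_hS)·∂*`** (`S·Sᵀ = 1 − E_last` and `Θ_h·E_last = 0`). [folklore] -/
theorem Th_mul_Dfw : Th h * Dfw n B = -(Th h * Sh n B) * Dbw n B := by
  rw [Dbw, mul_sub, mul_one, neg_mul, Matrix.mul_assoc, Sh_mul_transpose, mul_sub, mul_one, Th_mul_El, sub_zero,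
    Dfw, mul_sub, mul_one]
  abel

/-- `(SᵀΘ_h)·∂ + Ξ_h = Θ_h − SᵀΘ_h`. [folklore] -/
theorem transpose_Th_Dfw_add_Xi :
    (Sh n B).transpose * Th h * Dfw n B + Xi h = Th h - (Sh n B).transpose * Th h := by
  rw [Xi_eq, Dfw, mul_sub, mul_one]
  abel

/-- `−Θ_h·∂* + Ξ_h·Sᵀ = Θ_h − SᵀΘ_h`. [folklore] -/
theorem neg_Th_Dbw_add_Xi_transpose :
    -Th h * Dbw n B + Xi h * (Sh n B).transpose = Th h - (Sh n B).transpose * Th h := by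
  rw [Xi_eq, Dbw, mul_sub, mul_one, sub_mul, Matrix.mul_assoc ((Sh n B).transpose * Th h) (Sh n B)
    (Sh n B).transpose, Sh_mul_transpose, mul_sub, mul_one, Matrix.mul_assoc (Sh n B).transpose (Th h) (El n B),
    Th_mul_El, mul_zero, sub_zero]
  simp only [neg_mul]
  abel

/-- **THE `hM` SHAPE WITH `∇ = ∂*`: `∂·𝔇(∂*) = −Θ_h·∂* + Ξ_h·Sᵀ`** (coefficient operators `Dm₁ = −Θ_h` of order
`−1`, `Dm₀ = Ξ_hSᵀ` of order `−2`; exact, every `h`). [folklore] -/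
theorem D_mul_dDt_bw : Dfw n B * tdef (Matrix.diagonal h) (Matrix.diagonal h) (Dbw n B) (Dbw n B) =
    -Th h * Dbw n B + Xi h * (Sh n B).transpose := by
  rw [D_mul_dDt, transpose_Th_Dfw_add_Xi, neg_Th_Dbw_add_Xi_transpose]

/-- **THE `hΛ` SHAPE WITH `∇ = ∂*` for `Λ = ∂∂*`: `𝔇(∂∂*) = −(Θ_h + Θ_hS)·∂* + Ξ_h·Sᵀ`** (exact, every `h`).
[folklore] -/
theorem dDDt_eq_bw : tdef (Matrix.diagonal h) (Matrix.diagonal h) (Dfw n B * Dbw n B) (Dfw n B * Dbw n B) =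
    -(Th h + Th h * Sh n B) * Dbw n B + Xi h * (Sh n B).transpose := by
  rw [dDDt_eq, add_mul, add_assoc, transpose_Th_Dfw_add_Xi, ← neg_Th_Dbw_add_Xi_transpose, Th_mul_Dfw, neg_add,
    add_mul]
  simp only [neg_mul]
  abel

/-- [folklore] -/
theorem Th_mul_Sh_apply (x x' : Fin n × Fin B) : (Th h * Sh n B) x x' = fd h x * Sh n B x x' := by
  rw [Th, Matrix.diagonal_mul]

/-- [folklore] -/
theorem Xi_mul_transpose_apply (x x' : Fin n × Fin B) :
    (Xi h * (Sh n B).transpose) x x' = sd h x * Sh n B x' x := by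
  rw [Xi, Matrix.diagonal_mul, Matrix.transpose_apply]

end Algebra

/-! ## §3 The zone classes of `Θ_hS`, `Ξ_hSᵀ`, and the five coefficient operators of `h₄` at one constant -/

section Classes

variable {n B : ℕ} {N : Finset (Fin n)} {hN : N.Nonempty} {δ₀ : ℝ}
variable {U V : Type*} [DecidableEq V] {bu : Fin n × Fin B → U} {bv : Fin n × Fin B → V} {pU : U → Fin n}
  {pV : V → Fin n}
variable {h : Fin n × Fin B → ℝ} {ω₀ ω₁ : ℝ}

/-- **`Θ_hS ∈ 𝒵(−1, ω₀e^{δ₀})`**: one entry `θ_h(x)` per row, at the successor (block distance `≤ 1`), on zone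
rows. OURS. [folklore] -/
theorem opZon_Th_mul_Sh (hB : 0 < B) (hδ₀ : 0 < δ₀) (hω₀ : 0 ≤ ω₀) (hbu : ∀ x, pU (bu x) = x.1)
    (hbv : ∀ x, pV (bv x) = x.1)
    (hmod : ∀ e e', dE n B e e' ≤ (fun _ => (B : ℝ)) e →
      |h e - h e'| ≤ ω₀ * ((toyFrame n B N hN δ₀).sc (id (Prod.fst e)))⁻¹ * dE n B e e')
    (hzone : ∀ e e', dE n B e e' ≤ (fun _ => (B : ℝ)) e → h e ≠ h e' →
      (toyFrame n B N hN δ₀).β (id (Prod.fst e)) = 0) :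
    OpZon (toyFrame n B N hN δ₀) bu bv pU pV (-1) (ω₀ * Real.exp δ₀) (Th h * Sh n B) := by
  rw [show ω₀ * Real.exp δ₀ = ω₀ * Real.exp (δ₀ * 1) by rw [mul_one]]
  have hnz : ∀ x x', (Th h * Sh n B) x x' ≠ 0 → ι x' = ι x + 1 ∧ fd h x ≠ 0 := by
    intro x x' hT
    rw [Th_mul_Sh_apply, Sh_apply] at hT
    by_cases h1 : ι x' = ι x + 1
    · rw [if_pos h1, mul_one] at hT; exact ⟨h1, hT⟩
    · rw [if_neg h1, mul_zero] at hT; exact absurd rfl hT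
  refine opZon_local_toy hB hδ₀ hω₀ hbu hbv (fun x => ?_) (fun x x' hT => ?_) (fun x x' => ?_) (fun x x' hT => ?_)
  · refine card_le_one.2 fun a ha b hb => ?_
    rw [mem_filter] at ha hb
    exact ι_inj.1 (by have := (hnz x a ha.2).1; have := (hnz x b hb.2).1; omega)
  · exact bdist_le_one_of_succ (hnz x x' hT).1
  · rw [Th_mul_Sh_apply, Sh_apply, zpow_neg_one]
    by_cases h1 : ι x' = ι x + 1
    · rw [if_pos h1, mul_one]; exact abs_fd_le hB hω₀ hmod x
    · rw [if_neg h1, mul_zero, abs_zero]; positivity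
  · exact zone_of_fd_ne_zero hB hzone (hnz x x' hT).2

/-- **`Ξ_hSᵀ ∈ 𝒵(−2, ω₁e^{δ₀})`** GIVEN the proper-scale bound `|ξ_h| ≤ ω₁B⁻²` on the second differences: one
entry `ξ_h(x)` per row, at the predecessor. OURS. [folklore] -/
theorem opZon_Xi_mul_transpose (hB : 0 < B) (hδ₀ : 0 < δ₀) (hω₁ : 0 ≤ ω₁) (hbu : ∀ x, pU (bu x) = x.1)
    (hbv : ∀ x, pV (bv x) = x.1)
    (hzone : ∀ e e', dE n B e e' ≤ (fun _ => (B : ℝ)) e → h e ≠ h e' →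
      (toyFrame n B N hN δ₀).β (id (Prod.fst e)) = 0)
    (hξ : ∀ x, |sd h x| ≤ ω₁ * ((B : ℝ) ^ 2)⁻¹) :
    OpZon (toyFrame n B N hN δ₀) bu bv pU pV (-2) (ω₁ * Real.exp δ₀) (Xi h * (Sh n B).transpose) := by
  rw [show ω₁ * Real.exp δ₀ = ω₁ * Real.exp (δ₀ * 1) by rw [mul_one]]
  have hnz : ∀ x x', (Xi h * (Sh n B).transpose) x x' ≠ 0 → ι x = ι x' + 1 ∧ sd h x ≠ 0 := by
    intro x x' hT
    rw [Xi_mul_transpose_apply, Sh_apply] at hT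
    by_cases h1 : ι x = ι x' + 1
    · rw [if_pos h1, mul_one] at hT; exact ⟨h1, hT⟩
    · rw [if_neg h1, mul_zero] at hT; exact absurd rfl hT
  refine opZon_local_toy hB hδ₀ hω₁ hbu hbv (fun x => ?_) (fun x x' hT => ?_) (fun x x' => ?_) (fun x x' hT => ?_)
  · refine card_le_one.2 fun a ha b hb => ?_
    rw [mem_filter] at ha hb
    exact ι_inj.1 (by have := (hnz x a ha.2).1; have := (hnz x b hb.2).1; omega)
  · rw [(bdist_isPseudoDist n).symm]; exact bdist_le_one_of_succ (hnz x x' hT).1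
  · rw [Xi_mul_transpose_apply, Sh_apply, show ((-2 : ℤ)) = -((2 : ℕ) : ℤ) by norm_num, zpow_neg, zpow_natCast]
    by_cases h1 : ι x = ι x' + 1
    · rw [if_pos h1, mul_one]; exact hξ x
    · rw [if_neg h1, mul_zero, abs_zero]; positivity
  · have h2 := (hnz x x' hT).2
    rw [sd] at h2
    by_cases h1 : fd h x = 0
    · rw [h1, zero_sub, neg_ne_zero] at h2; exact zone_of_bfd_ne_zero hB hzone h2
    · exact zone_of_fd_ne_zero hB hzone h1

variable {M I₀ : ℕ}

/-- the ONE constant of the Leibniz block of the smooth-cutoff datum: `θ_H = (3/2)(1/M)(1 + e^{δ₀}) + (6/M²)e^{δ₀}`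
(`O(M⁻¹)`, uniform in `B`, `n`, `I₀`; it dominates Toy4's `thetaL`). OURS (typing). [folklore] -/
def thetaH (M : ℕ) (δ₀ : ℝ) : ℝ :=
  3 / 2 * (1 / M) * (1 + Real.exp δ₀) + 6 * (1 / (M : ℝ)) ^ 2 * Real.exp δ₀

/-- [folklore] -/
theorem thetaH_nonneg : 0 ≤ thetaH M δ₀ := by unfold thetaH; positivity

/-- `θ_L ≤ θ_H` for `0 ≤ δ₀`. [folklore] -/
theorem thetaL_le_thetaH (hδ₀ : 0 ≤ δ₀) : thetaL M δ₀ ≤ thetaH M δ₀ := by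
  unfold thetaL thetaH
  have h1 := Real.one_le_exp hδ₀
  have h2 : 0 ≤ 6 * (1 / (M : ℝ)) ^ 2 := by positivity
  nlinarith

/-- **(L) `Lm₁ = −(Θ + ΘS) ∈ 𝒵(−1, θ_H)`** for `h₄` on the toy frame of the ramp zone (any block maps over the
block projection). OURS. [folklore] -/
theorem h4_zLm₁bw (hB : 0 < B) (hM : 0 < M) (hIM : I₀ + M < n) (hδ₀ : 0 < δ₀) (hbu : ∀ x, pU (bu x) = x.1)
    (hbv : ∀ x, pV (bv x) = x.1) :
    OpZon (toyFrame n B (rampZone n M I₀) (rampZone_nonempty (lt_of_hIM hIM)) δ₀) bu bv pU pV (-1) (thetaH M δ₀)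
      (-(Th (h4 n B M I₀) + Th (h4 n B M I₀) * Sh n B)) := by
  have hN := rampZone_nonempty (n := n) (M := M) (lt_of_hIM hIM)
  refine B9SectCDiffDict.opZon_mono (toyFrame_valid hB hN hδ₀)
    (opZon_neg (B9SectCDiffDict.opZon_add
      (opZon_Th hB hδ₀ (by positivity) hbu hbv (h4_modulus hB hM _) (h4_zone hB hM hN))
      (opZon_Th_mul_Sh hB hδ₀ (by positivity) hbu hbv (h4_modulus hB hM _) (h4_zone hB hM hN))))
    (by positivity) ?_
  unfold thetaH
  have : 0 ≤ 6 * (1 / (M : ℝ)) ^ 2 * Real.exp δ₀ := by positivity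
  linarith

/-- **(L) `Dm₁ = −Θ ∈ 𝒵(−1, θ_H)`** for `h₄`. OURS. [folklore] -/
theorem h4_zDm₁bw (hB : 0 < B) (hM : 0 < M) (hIM : I₀ + M < n) (hδ₀ : 0 < δ₀) (hbu : ∀ x, pU (bu x) = x.1)
    (hbv : ∀ x, pV (bv x) = x.1) :
    OpZon (toyFrame n B (rampZone n M I₀) (rampZone_nonempty (lt_of_hIM hIM)) δ₀) bu bv pU pV (-1) (thetaH M δ₀)
      (-Th (h4 n B M I₀)) := by
  have hN := rampZone_nonempty (n := n) (M := M) (lt_of_hIM hIM)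
  refine B9SectCDiffDict.opZon_mono (toyFrame_valid hB hN hδ₀)
    (opZon_neg (opZon_Th hB hδ₀ (by positivity) hbu hbv (h4_modulus hB hM _) (h4_zone hB hM hN)))
    (by positivity) ?_
  unfold thetaH
  have h1 : 0 ≤ 6 * (1 / (M : ℝ)) ^ 2 * Real.exp δ₀ := by positivity
  have h2 : 0 ≤ 3 / 2 * (1 / (M : ℝ)) * Real.exp δ₀ := by positivity
  linarith

/-- **(L) `Lm₀ = Dm₀ = ΞSᵀ ∈ 𝒵(−2, θ_H)`** for `h₄` (`|ξ_{h₄}| ≤ 6/(MB)²`, Toy4 `abs_sd_h4_le`). OURS. [folklore] -/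
theorem h4_zXiSt (hB : 0 < B) (hM : 0 < M) (hIM : I₀ + M < n) (hδ₀ : 0 < δ₀) (hbu : ∀ x, pU (bu x) = x.1)
    (hbv : ∀ x, pV (bv x) = x.1) :
    OpZon (toyFrame n B (rampZone n M I₀) (rampZone_nonempty (lt_of_hIM hIM)) δ₀) bu bv pU pV (-2) (thetaH M δ₀)
      (Xi (h4 n B M I₀) * (Sh n B).transpose) := by
  have hN := rampZone_nonempty (n := n) (M := M) (lt_of_hIM hIM)
  have hξ : ∀ x, |sd (h4 n B M I₀) x| ≤ 6 * (1 / (M : ℝ)) ^ 2 * ((B : ℝ) ^ 2)⁻¹ := fun x => by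
    have h1 := abs_sd_h4_le hB hM hIM x
    calc |sd (h4 n B M I₀) x| ≤ 6 * ((1 / M) * (B : ℝ)⁻¹) ^ 2 := h1
      _ = 6 * (1 / (M : ℝ)) ^ 2 * ((B : ℝ) ^ 2)⁻¹ := by rw [mul_pow, inv_pow]; ring
  refine B9SectCDiffDict.opZon_mono (toyFrame_valid hB hN hδ₀)
    (opZon_Xi_mul_transpose hB hδ₀ (by positivity) hbu hbv (h4_zone hB hM hN) hξ) (by positivity) ?_
  unfold thetaH
  have : 0 ≤ 3 / 2 * (1 / (M : ℝ)) * (1 + Real.exp δ₀) := by positivity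
  linarith

/-- **(L) `Am₁ = Θ + SᵀΘ ∈ 𝒵(−1, θ_H)`** for `h₄` (Toy4's `h4_zLm₁` at `θ_L ≤ θ_H`). OURS. [folklore] -/
theorem h4_zAm₁H (hB : 0 < B) (hM : 0 < M) (hIM : I₀ + M < n) (hδ₀ : 0 < δ₀) (hbu : ∀ x, pU (bu x) = x.1)
    (hbv : ∀ x, pV (bv x) = x.1) :
    OpZon (toyFrame n B (rampZone n M I₀) (rampZone_nonempty (lt_of_hIM hIM)) δ₀) bu bv pU pV (-1) (thetaH M δ₀)
      (Th (h4 n B M I₀) + (Sh n B).transpose * Th (h4 n B M I₀)) :=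
  B9SectCDiffDict.opZon_mono (toyFrame_valid hB (rampZone_nonempty (lt_of_hIM hIM)) hδ₀)
    (h4_zLm₁ hB hM hIM hδ₀ hbu hbv) thetaL_nonneg (thetaL_le_thetaH hδ₀.le)

/-- **(L) `Am₀ = Ξ ∈ 𝒵(−2, θ_H)`** for `h₄` (Toy4's `h4_zLm₀` at `θ_L ≤ θ_H`). OURS. [folklore] -/
theorem h4_zAm₀H (hB : 0 < B) (hM : 0 < M) (hIM : I₀ + M < n) (hδ₀ : 0 < δ₀) (hbu : ∀ x, pU (bu x) = x.1)
    (hbv : ∀ x, pV (bv x) = x.1) :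
    OpZon (toyFrame n B (rampZone n M I₀) (rampZone_nonempty (lt_of_hIM hIM)) δ₀) bu bv pU pV (-2) (thetaH M δ₀)
      (Xi (h4 n B M I₀)) :=
  B9SectCDiffDict.opZon_mono (toyFrame_valid hB (rampZone_nonempty (lt_of_hIM hIM)) hδ₀)
    (h4_zLm₀ hB hM hIM hδ₀ hbu hbv) thetaL_nonneg (thetaL_le_thetaH hδ₀.le)

end Classes

/-! ## §4 The h-free record of `Q′*` with all coarse elements as window -/

section Records

variable {n B : ℕ}

/-- a non-zero entry of `Q′*` sits in the block of its column and equals `1`. [folklore] -/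
theorem Qpt_ne_zero {a : Fin n × Fin B} {J : Fin n} (h : Qpt n B a J ≠ 0) : a.1 = J ∧ Qpt n B a J = 1 := by
  unfold Qpt at h ⊢
  by_cases ha : a.1 = J
  · exact ⟨ha, if_pos ha⟩
  · exact absurd (if_neg ha) h

/-- **h-FREE LOCALITY OF `Q′*` AT ALL COLUMNS** (the `CutModel.locQt₂` / `locQ't₂` shape with identity window).
[folklore] -/
theorem locQpt2 (hB : 0 < B) : ∀ (a : Fin n × Fin B) (J : Fin n), Qpt n B a J ≠ 0 →
    dE n B (xS hB J) a ≤ (fun _ => (B : ℝ)) (xS hB J) := by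
  intro a J hT
  have h := dE_xS_of_fst_eq hB (Qpt_ne_zero hT).1
  show dE n B (xS hB J) a ≤ (B : ℝ)
  linarith

variable {N : Finset (Fin n)} {hN : N.Nonempty} {δ₀ : ℝ}

/-- **THE RECORD OF `Q′*` (the `CutModel.lQt` / `lQ't` shape) INHABITED with identity window**: rows = all fine
sites at their own positions, column positions `x_S`, column blocks = the coarse elements themselves; range /
locality `≤ B`, singleton column-block row sums `≤ 1·e^{−δ₀ρ}`. OURS. [folklore] -/
theorem opLoc_Qpt (hB : 0 < B) :
    OpLoc (lineFrame n B N hN δ₀) id id (dE n B) (fun _ => (B : ℝ)) 0 ⟨1, 1, 1⟩ (Qpt n B) id id (xS hB)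
      Prod.fst id where
  r_nonneg := zero_le_one
  c_nonneg := zero_le_one
  rng a J _ hT := by
    have h : dE n B (xS hB J) a ≤ (B : ℝ) - 1 := dE_xS_of_fst_eq hB (Qpt_ne_zero hT).1
    show dE n B a (xS hB J) ≤ 1 * (B : ℝ) ^ (1 : ℤ)
    rw [dE_comm, one_mul, zpow_one]
    linarith
  loc a J hT := by
    have h : dE n B (xS hB J) a ≤ (B : ℝ) - 1 := dE_xS_of_fst_eq hB (Qpt_ne_zero hT).1
    show dE n B a (xS hB J) ≤ (B : ℝ)
    rw [dE_comm]
    linarith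
  maj a J _ := by
    show ∑ J' ∈ univ.filter (fun J' : Fin n => id J' = J), |Qpt n B (id a) J'| ≤
      1 * (B : ℝ) ^ ((0 : ℤ) + 1 - 1) * Real.exp (-(δ₀ * bdist n (id (Prod.fst a)) (id J)))
    have hf : univ.filter (fun J' : Fin n => id J' = J) = {J} := by ext J'; simp
    rw [hf, sum_singleton, show ((0 : ℤ) + 1 - 1) = 0 by norm_num, zpow_zero, one_mul, one_mul]
    simp only [id_eq]
    by_cases hT : Qpt n B a J = 0
    · rw [hT, abs_zero]; exact Real.exp_nonneg _
    · obtain ⟨h1, h2⟩ := Qpt_ne_zero hT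
      rw [h2, abs_one, ← h1, bdist_self, mul_zero, neg_zero, Real.exp_zero]

end Records

/-! ## §5 The smooth-cutoff datum `Xh` and its complete cut model -/

section Datum

variable {n B M I₀ : ℕ} {δ₀ a : ℝ}

/-- `0 < B` for `2²⁰ ≤ a ≤ B`. [folklore] -/
theorem hBpos_of (ha : 1048576 ≤ a) (haB : a ≤ (B : ℝ)) : 0 < B := by
  have hBr : (0 : ℝ) < B := by linarith
  exact_mod_cast hBr

/-- **THE SMOOTH-CUTOFF DATUM** `Xh`: Toy10's diagonal datum `Xdiag` (the genuine toy operators with `∂ ≠ 0` for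
BOTH sequences, `μ = (a/B)²`, `2²⁰ ≤ a ≤ B`) with the NON-TRIVIAL intertwiners `χs = χb = diag(h₄)` (Toy4's `C¹`
smoothed ramp cutoff of width `M` blocks starting at block `I₀`) on the fine carrier and `ψS = ψB = cutX id id
(h₄ ∘ x_S)` (the cutoff read at the block positions) on the coarse carriers.  HONEST: the two operator sequences
COINCIDE; the defects are commutators with the cutoff.  OURS (typing). [folklore] -/
def Xh (n B M I₀ : ℕ) (a : ℝ) (ha : 1048576 ≤ a) (haB : a ≤ (B : ℝ)) :
    TwoSeq (Fin n × Fin B) (Fin n × Fin B) (Fin n) (Fin n) (Fin n) (Fin n) :=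
  { Xdiag n B a ha haB with
    χs := Matrix.diagonal (h4 n B M I₀)
    χb := Matrix.diagonal (h4 n B M I₀)
    ψS := cutX id id fun I => h4 n B M I₀ (xS (hBpos_of ha haB) I)
    ψB := cutX id id fun I => h4 n B M I₀ (xS (hBpos_of ha haB) I) }

variable {ha : 1048576 ≤ a} {haB : a ≤ (B : ℝ)}

/-- [folklore] -/
@[simp] theorem Xh_χs : (Xh n B M I₀ a ha haB).χs = Matrix.diagonal (h4 n B M I₀) := rfl
/-- [folklore] -/
@[simp] theorem Xh_χb : (Xh n B M I₀ a ha haB).χb = Matrix.diagonal (h4 n B M I₀) := rfl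
/-- [folklore] -/
@[simp] theorem Xh_ψS :
    (Xh n B M I₀ a ha haB).ψS = cutX id id fun I => h4 n B M I₀ (xS (hBpos_of ha haB) I) := rfl
/-- [folklore] -/
@[simp] theorem Xh_ψB :
    (Xh n B M I₀ a ha haB).ψB = cutX id id fun I => h4 n B M I₀ (xS (hBpos_of ha haB) I) := rfl
/-- [folklore] -/
@[simp] theorem Xh_D : (Xh n B M I₀ a ha haB).D = Dfw n B := rfl
/-- [folklore] -/
@[simp] theorem Xh_Dt : (Xh n B M I₀ a ha haB).Dt = Dbw n B := rfl
/-- [folklore] -/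
@[simp] theorem Xh_Λ : (Xh n B M I₀ a ha haB).Λ = Lam n B ((a / B) ^ 2) := rfl
/-- [folklore] -/
@[simp] theorem Xh_Λ' :
    (Xh n B M I₀ a ha haB).Λ' = ((a / B) ^ 2 : ℝ) • (1 : Matrix (Fin n × Fin B) (Fin n × Fin B) ℝ) := rfl
/-- [folklore] -/
@[simp] theorem Xh_Q₁ : (Xh n B M I₀ a ha haB).Q₁ = Qp n B := rfl
/-- [folklore] -/
@[simp] theorem Xh_Q₂ : (Xh n B M I₀ a ha haB).Q₂ = Qp n B := rfl
/-- [folklore] -/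
@[simp] theorem Xh_Qt₁ : (Xh n B M I₀ a ha haB).Qt₁ = Qpt n B := rfl
/-- [folklore] -/
@[simp] theorem Xh_Qt₂ : (Xh n B M I₀ a ha haB).Qt₂ = Qpt n B := rfl
/-- [folklore] -/
@[simp] theorem Xh_Q'₂ : (Xh n B M I₀ a ha haB).Q'₂ = Qp n B := rfl
/-- [folklore] -/
@[simp] theorem Xh_Q't₂ : (Xh n B M I₀ a ha haB).Q't₂ = Qpt n B := rfl
/-- [folklore] -/
@[simp] theorem Xh_A₂ : (Xh n B M I₀ a ha haB).A₂ = 0 := rfl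
/-- [folklore] -/
@[simp] theorem Xh_A'₂ : (Xh n B M I₀ a ha haB).A'₂ = 0 := rfl
/-- [folklore] -/
@[simp] theorem Xh_G'₂ : (Xh n B M I₀ a ha haB).G'₂ = Gr n B ((a / B) ^ 2) := rfl
/-- [folklore] -/
@[simp] theorem Xh_C₂ : (Xh n B M I₀ a ha haB).C₂ = (E2 n B ((a / B) ^ 2))⁻¹ := rfl
/-- [folklore] -/
@[simp] theorem Xh_G₁ : (Xh n B M I₀ a ha haB).G₁ = Gtoy n B ((a / B) ^ 2) ((a / B) ^ 2) := rfl
/-- [folklore] -/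
@[simp] theorem Xh_G₂ : (Xh n B M I₀ a ha haB).G₂ = Gtoy n B ((a / B) ^ 2) ((a / B) ^ 2) := rfl

/-- HONEST: the two coarse operators of the smooth-cutoff datum coincide (`T₁ = T₂ = Q′·Gtoy·Q′*`). [folklore] -/
theorem Xh_T₁_eq_T₂ : (Xh n B M I₀ a ha haB).T₁ = (Xh n B M I₀ a ha haB).T₂ := rfl

/-- **THE DEFECT OF `T` IS THE COMMUTATOR WITH THE BLOCK CUTOFF**:
`𝔇(T)(I, J) = (h₄(x_S I) − h₄(x_S J))·(Q′·Gtoy·Q′*)(I, J)`. [folklore] -/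
theorem Xh_dT_apply (I J : Fin n) :
    (Xh n B M I₀ a ha haB).dT I J =
      (h4 n B M I₀ (xS (hBpos_of ha haB) I) - h4 n B M I₀ (xS (hBpos_of ha haB) J)) *
        (Qp n B * Gtoy n B ((a / B) ^ 2) ((a / B) ^ 2) * Qpt n B) I J := by
  show tdef (cutX id id fun I => h4 n B M I₀ (xS (hBpos_of ha haB) I))
      (cutX id id fun I => h4 n B M I₀ (xS (hBpos_of ha haB) I))
      (Qp n B * Gtoy n B ((a / B) ^ 2) ((a / B) ^ 2) * Qpt n B)
      (Qp n B * Gtoy n B ((a / B) ^ 2) ((a / B) ^ 2) * Qpt n B) I J = _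
  rw [cutX_id_id, B9SectCDiff.tdef_def, Matrix.sub_apply, Matrix.diagonal_mul, Matrix.mul_diagonal]
  ring

/-- **THE COMPLETE CUT MODEL OF THE SMOOTH-CUTOFF DATUM** over the toy frame of the ramp zone `rampZone n M I₀`,
frame sites `id` / `id`, block maps `Prod.fst` (sites, bonds, 2-tensors) and `id` (coarse) for both sequences,
`∇ = ∂* = Dbw`, positions `E = Fin n × Fin B`, identity windows.  ALL 76 fields: `h := h₄` (`h4_modulus`, `ω₀ =
(3/2)(1/M)`; `h4_zone`), the four cutoffs of `Xh` ARE its values (`rfl`), far facts vacuous, agreement `rfl`; the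
seven h-free records `opLoc_Qp` (Q, Q′: `r = κ = c = 1`), `opLoc_Qpt` (Q*, Q′*), `opLoc_Dfw` / `opLoc_Dbw` (∂, ∂*:
`r = 1`, `κ = 0`, `c = 2e^{δ₀}`), `opLoc_zero` (A = 0); the Leibniz block `Lm₁ = −(Θ + ΘS)`, `Lm₀ = Dm₀ = ΞSᵀ`,
`Dm₁ = −Θ`, `Am₁ = Θ + SᵀΘ`, `Am₀ = Ξ` at `θL = thetaH M δ₀` by §2–§3.  Hypotheses `2²⁰ ≤ a ≤ B`, `0 < M`,
`I₀ + M < n`, `0 < δ₀`.  OURS. [folklore] -/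
def cutXh (hM : 0 < M) (hIM : I₀ + M < n) (hδ₀ : 0 < δ₀) :
    CutModel (toyFrame n B (rampZone n M I₀) (rampZone_nonempty (lt_of_hIM hIM)) δ₀) (Xh n B M I₀ a ha haB) id id
      Prod.fst Prod.fst id id Prod.fst Prod.fst Prod.fst id id (Dbw n B) (Fin n × Fin B) (Fin n) (Fin n) where
  dE := dE n B
  h := h4 n B M I₀
  ℓ := fun _ => (B : ℝ)
  ω₀ := 3 / 2 * (1 / M)
  blk := Prod.fst
  xs := id
  xb := id
  xS₁ := xS (hBpos_of ha haB)
  xS₂ := xS (hBpos_of ha haB)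
  xB₁ := xS (hBpos_of ha haB)
  xB₂ := xS (hBpos_of ha haB)
  fS₁ := id
  fS₂ := id
  fB₁ := id
  fB₂ := id
  oQ := ⟨1, 1, 1⟩
  oQt := ⟨1, 1, 1⟩
  oD := ⟨1, 0, 2 * Real.exp δ₀⟩
  oDt := ⟨1, 0, 2 * Real.exp δ₀⟩
  oA := ⟨0, 0, 0⟩
  oQ' := ⟨1, 1, 1⟩
  oQ't := ⟨1, 1, 1⟩
  θL := thetaH M δ₀
  Lm₁ := -(Th (h4 n B M I₀) + Th (h4 n B M I₀) * Sh n B)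
  Lm₀ := Xi (h4 n B M I₀) * (Sh n B).transpose
  Dm₁ := -Th (h4 n B M I₀)
  Dm₀ := Xi (h4 n B M I₀) * (Sh n B).transpose
  Am₁ := Th (h4 n B M I₀) + (Sh n B).transpose * Th (h4 n B M I₀)
  Am₀ := Xi (h4 n B M I₀)
  hω₀ := by positivity
  fS₁_inj := Function.injective_id
  fS₂_inj := Function.injective_id
  fB₁_inj := Function.injective_id
  fB₂_inj := Function.injective_id
  xfS _ := rfl
  xfB _ := rfl
  blk_s _ := rfl
  blk_b _ := rfl
  blk_S _ := rfl
  blk_B _ := rfl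
  hχs := rfl
  hχb := rfl
  hψS := rfl
  hψB := rfl
  modulus := h4_modulus (N := rampZone n M I₀) (hN := rampZone_nonempty (lt_of_hIM hIM)) (δ₀ := δ₀)
    (hBpos_of ha haB) hM _
  zone := h4_zone (δ₀ := δ₀) (hBpos_of ha haB) hM (rampZone_nonempty (lt_of_hIM hIM))
  farS₁ I hI := absurd ⟨I, rfl⟩ hI
  farS₂ J hJ := absurd ⟨J, rfl⟩ hJ
  farB₁ I hI := absurd ⟨I, rfl⟩ hI
  farB₂ J hJ := absurd ⟨J, rfl⟩ hJ
  agQ _ _ _ := rfl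
  agQt _ _ _ := rfl
  agA _ _ _ := rfl
  agQ' _ _ _ := rfl
  agQ't _ _ _ := rfl
  lQ := opLoc_toy (opLoc_Qp (hBpos_of ha haB))
  lQt := opLoc_toy (opLoc_Qpt (hBpos_of ha haB))
  lD := opLoc_toy (opLoc_Dfw (hBpos_of ha haB) hδ₀.le)
  lDt := opLoc_toy (opLoc_Dbw (hBpos_of ha haB) hδ₀.le)
  lA := opLoc_zero _ _ _ _ _ _ _ _ _ _ _ _
  lQ' := opLoc_toy (opLoc_Qp (hBpos_of ha haB))
  lQ't := opLoc_toy (opLoc_Qpt (hBpos_of ha haB))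
  locQ₁ := locQp1 (hBpos_of ha haB)
  locQ'₁ := locQp1 (hBpos_of ha haB)
  locQt₂ := locQpt2 (hBpos_of ha haB)
  locQ't₂ := locQpt2 (hBpos_of ha haB)
  hθL := thetaH_nonneg
  hΛ := by
    show tdef (Matrix.diagonal (h4 n B M I₀)) (Matrix.diagonal (h4 n B M I₀)) (Lam n B ((a / B) ^ 2))
        (Lam n B ((a / B) ^ 2)) = _
    unfold Lam
    rw [B9SectCDiff.tdef_add, B9SectCDiff.tdef_smul, B9SectCDiff.tdef_one, smul_zero, zero_add]
    exact dDDt_eq_bw _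
  zLm₁ := h4_zLm₁bw (hBpos_of ha haB) hM hIM hδ₀ (fun _ => rfl) (fun _ => rfl)
  zLm₀ := h4_zXiSt (hBpos_of ha haB) hM hIM hδ₀ (fun _ => rfl) (fun _ => rfl)
  hM := D_mul_dDt_bw _
  zDm₁ := h4_zDm₁bw (hBpos_of ha haB) hM hIM hδ₀ (fun _ => rfl) (fun _ => rfl)
  zDm₀ := h4_zXiSt (hBpos_of ha haB) hM hIM hδ₀ (fun _ => rfl) (fun _ => rfl)
  hA := by
    show tdef (Matrix.diagonal (h4 n B M I₀)) (Matrix.diagonal (h4 n B M I₀))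
        (Dbw n B * Dfw n B + ((a / B) ^ 2 : ℝ) • (1 : Matrix (Fin n × Fin B) (Fin n × Fin B) ℝ) + 0)
        (Dbw n B * Dfw n B + ((a / B) ^ 2 : ℝ) • (1 : Matrix (Fin n × Fin B) (Fin n × Fin B) ℝ) + 0) = _
    rw [add_zero]
    exact (leibniz_affine (h4 n B M I₀) 0 0 ((a / B) ^ 2)).2.2
  zAm₁ := h4_zAm₁H (hBpos_of ha haB) hM hIM hδ₀ (fun _ => rfl) (fun _ => rfl)
  zAm₀ := h4_zAm₀H (hBpos_of ha haB) hM hIM hδ₀ (fun _ => rfl) (fun _ => rfl)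

/-- the common (L) constant of the smooth-cutoff datum: `θ_X = (15/2)(1/M)(1 + e^{δ₀}) + (6/M²)e^{δ₀}` — `O(M⁻¹)`,
uniform in `B`, `n`, `I₀`, `a`. OURS (typing). [folklore] -/
def thetaX (M : ℕ) (δ₀ : ℝ) : ℝ :=
  15 / 2 * (1 / M) * (1 + Real.exp δ₀) + 6 * (1 / (M : ℝ)) ^ 2 * Real.exp δ₀

/-- [folklore] -/
theorem thetaX_nonneg : 0 ≤ thetaX M δ₀ := by unfold thetaX; positivity

/-- **`θ_X ≤ 48/M`** for `0 < M`, `δ₀ ≤ 1` (`e^{δ₀} ≤ e < 3`). [folklore] -/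
theorem thetaX_le (hM : 0 < M) (hδ : δ₀ ≤ 1) : thetaX M δ₀ ≤ 48 / M := by
  have hMr : (0 : ℝ) < M := by exact_mod_cast hM
  have hm0 : 0 ≤ 1 / (M : ℝ) := by positivity
  have hm1 : 1 / (M : ℝ) ≤ 1 := by
    rw [div_le_one hMr]; exact_mod_cast hM
  have he : Real.exp δ₀ ≤ 3 :=
    (Real.exp_le_exp.2 hδ).trans (Real.exp_one_lt_d9.le.trans (by norm_num))
  have he0 : 0 ≤ Real.exp δ₀ := (Real.exp_pos _).le
  have h1 : (1 / (M : ℝ)) ^ 2 ≤ 1 / M := by rw [sq]; exact mul_le_of_le_one_left hm0 hm1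
  unfold thetaX
  calc 15 / 2 * (1 / (M : ℝ)) * (1 + Real.exp δ₀) + 6 * (1 / (M : ℝ)) ^ 2 * Real.exp δ₀
      ≤ 15 / 2 * (1 / (M : ℝ)) * 4 + 6 * (1 / (M : ℝ)) * 3 :=
        add_le_add (mul_le_mul_of_nonneg_left (by linarith) (by positivity))
          (mul_le_mul (mul_le_mul_of_nonneg_left h1 (by norm_num)) he he0 (by positivity))
    _ = 48 / M := by ring

/-- **the common (L) constant of `cutXh` is `θ_X`**: `θ = ω₀·Σ_T r_T c_T + θL` with `ω₀ = (3/2)(1/M)`, four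
Q-type records with `r·c = 1`, two ∂-type records with `r·c = 2e^{δ₀}`, one zero record, `θL = thetaH`. OURS.
[folklore] -/
theorem cutXh_theta (hM : 0 < M) (hIM : I₀ + M < n) (hδ₀ : 0 < δ₀) :
    (cutXh (ha := ha) (haB := haB) hM hIM hδ₀).theta = thetaX M δ₀ := by
  show 3 / 2 * (1 / (M : ℝ)) * (1 * 1 + 1 * 1 + 1 * (2 * Real.exp δ₀) + 1 * (2 * Real.exp δ₀) + 0 * 0 + 1 * 1
    + 1 * 1) + thetaH M δ₀ = thetaX M δ₀
  unfold thetaH thetaX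
  ring

/-- [folklore] -/
@[simp] theorem cutXh_h (hM : 0 < M) (hIM : I₀ + M < n) (hδ₀ : 0 < δ₀) :
    (cutXh (ha := ha) (haB := haB) hM hIM hδ₀).h = h4 n B M I₀ := rfl

/-- [folklore] -/
@[simp] theorem cutXh_ω₀ (hM : 0 < M) (hIM : I₀ + M < n) (hδ₀ : 0 < δ₀) :
    (cutXh (ha := ha) (haB := haB) hM hIM hδ₀).ω₀ = 3 / 2 * (1 / M) := rfl

/-- [folklore] -/
@[simp] theorem cutXh_θL (hM : 0 < M) (hIM : I₀ + M < n) (hδ₀ : 0 < δ₀) :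
    (cutXh (ha := ha) (haB := haB) hM hIM hδ₀).θL = thetaH M δ₀ := rfl

/-- **THE `(L)` BUNDLE OF THE SMOOTH-CUTOFF DATUM**: THEOREM D's sixteen (L) fields for `Xh` on the toy frame of the
ramp zone at `θ = cutXh.theta = θ_X`, by the cell's `CutModel.toLDat` (seven `opZon_of_geom` + `opZon_mono`; the
Leibniz block of §2–§3).  OURS. [folklore] -/
def ldatXh (hM : 0 < M) (hIM : I₀ + M < n) (hδ₀ : 0 < δ₀) :
    LDat (toyFrame n B (rampZone n M I₀) (rampZone_nonempty (lt_of_hIM hIM)) δ₀) (Xh n B M I₀ a ha haB) id id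
      Prod.fst Prod.fst id id Prod.fst Prod.fst Prod.fst id id (Dbw n B)
      (cutXh (ha := ha) (haB := haB) hM hIM hδ₀).theta :=
  (cutXh hM hIM hδ₀).toLDat (toyFrame_valid (hBpos_of ha haB) _ hδ₀)

end Datum

/-! ## §6 The `(M)` bundles of the smooth-cutoff datum at `c = 3a⁴` -/

section MBundles

variable {n B M I₀ : ℕ} {N : Finset (Fin n)} {hN : N.Nonempty} {δ₀ a : ℝ} {ha : 1048576 ≤ a} {haB : a ≤ (B : ℝ)}

/-- **(M) OF SEQUENCE 1 for the smooth-cutoff datum at `c = 3a⁴`** (Toy10's parametric `mOne_of_seq1`; the (M)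
classes do not see the intertwiners). [folklore] -/
theorem mOne_Xh (hδ : δ₀ ≤ 1 / 2) :
    MOne (toyFrame n B N hN δ₀) (Xh n B M I₀ a ha haB) id Prod.fst Prod.fst id id (3 * a ^ 4) :=
  mOne_of_seq1 (Xh n B M I₀ a ha haB) rfl rfl rfl rfl rfl rfl rfl ha haB hδ

/-- **(M) OF SEQUENCE 2 for the smooth-cutoff datum at `c = 3a⁴` WITH `∇ := ∂*`**: the nine slots of `MTwo` as in
Toy10's `mTwo_Xdiag`, except that `mDvG` is now the genuine `∂*·Gtoy ∈ 𝒟(0, 1, 3·10¹⁰/a) ⊆ 𝒟(0, 1, 3a⁴)`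
(`DbwGtoy_opDec_num`) instead of the zero operator. [folklore] -/
theorem mTwo_Xh (hδ : δ₀ ≤ 1 / 2) :
    MTwo (toyFrame n B N hN δ₀) (Xh n B M I₀ a ha haB) id Prod.fst Prod.fst Prod.fst id id (Dbw n B)
      (3 * a ^ 4) := by
  have ha0 : 0 < a := by linarith
  have hB : 0 < B := hBpos_of ha haB
  obtain ⟨h1, hcG, hcD, hcGr, -, hcDt⟩ := bundle_consts ha
  exact
    { mG := opDec_toy_mono (Gtoy_opDec_num ha haB hδ) (by positivity) hcG
      mQt := opDec_Qpt h1
      mDtG := opDec_toy_mono (DbwGtoy_opDec_num ha haB hδ) (by positivity) hcDt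
      mDvG := opDec_toy_mono (DbwGtoy_opDec_num ha haB hδ) (by positivity) hcDt
      mG' := opDec_toy_mono (Gr_opDec_num (by linarith) haB hδ) (by
          have : 0 < a - 1 := by linarith
          positivity) hcGr
      mDG' := opDec_toy_mono (DGr_opDec_num (by linarith) haB hδ) (by
          have : 0 < a - 2 := by linarith
          positivity) hcD
      mQ't := opDec_Qpt h1
      mC := E2_inv_opDec_num (by linarith) haB hδ
      mQ' := opDec_of_rowsum (Qp_rowsum hB) h1 }

end MBundles

/-! ## §7 THEOREM D for the smooth-cutoff datum on the decaying frame -/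

section EstD

variable {n B M I₀ : ℕ} {δ₀ a : ℝ} {ha : 1048576 ≤ a} {haB : a ≤ (B : ℝ)}

/-- `1 ≤ 3a⁴` for `2²⁰ ≤ a`. [folklore] -/
theorem one_le_c3 (ha : 1048576 ≤ a) : (1 : ℝ) ≤ 3 * a ^ 4 := (bundle_consts ha).1

/-- **`EstHyp` FOR THE SMOOTH-CUTOFF DATUM ON THE DECAYING FRAME**: §6's `mOne_Xh`, `mTwo_Xh` (constant `3a⁴`) and
§5's `ldatXh` (`θ = θ_X`) transported to Toy13's `toyFrameD` (level-0 transport), the volume-free profile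
`toyFrameD_profile₁` for both block families, assembled by the cell's `assemble`; hypotheses `2²⁰ ≤ a ≤ B`, `0 < M`,
`I₀ + M < n`, `0 < δ₀ ≤ 1/2`.  OURS. [folklore] -/
def estHypXhD (hM : 0 < M) (hIM : I₀ + M < n) (hδ₀ : 0 < δ₀) (hδ : δ₀ ≤ 1 / 2) :
    EstHyp (toyFrameD n B (rampZone n M I₀) (rampZone_nonempty (lt_of_hIM hIM)) δ₀) (Xh n B M I₀ a ha haB)
      (Fin n × Fin B) (Fin n) (Fin n) :=
  assemble (toyFrameD_valid (hBpos_of ha haB) _ hδ₀) (mOne_toyD (mOne_Xh hδ)) (mTwo_toyD (mTwo_Xh hδ))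
    (ldatToyD (ldatXh hM hIM hδ₀)) (by positivity) (by positivity) (cutXh hM hIM hδ₀).theta_nonneg
    toyFrameD_profile₁ toyFrameD_profile₁

/-- the assembled (M) constant is `max(1, 3a⁴, 3a⁴) = 3a⁴`. [folklore] -/
theorem estHypXhD_c (hM : 0 < M) (hIM : I₀ + M < n) (hδ₀ : 0 < δ₀) (hδ : δ₀ ≤ 1 / 2) :
    (estHypXhD (ha := ha) (haB := haB) hM hIM hδ₀ hδ).c = 3 * a ^ 4 := by
  show max 1 (max (3 * a ^ 4) (3 * a ^ 4)) = 3 * a ^ 4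
  rw [max_self, max_eq_right (one_le_c3 ha)]

/-- the assembled (L) constant is `θ_X`. [folklore] -/
theorem estHypXhD_θ (hM : 0 < M) (hIM : I₀ + M < n) (hδ₀ : 0 < δ₀) (hδ : δ₀ ≤ 1 / 2) :
    (estHypXhD (ha := ha) (haB := haB) hM hIM hδ₀ hδ).θ = thetaX M δ₀ :=
  cutXh_theta hM hIM hδ₀

/-- [folklore] -/
theorem estHypXhD_p₁ (hM : 0 < M) (hIM : I₀ + M < n) (hδ₀ : 0 < δ₀) (hδ : δ₀ ≤ 1 / 2) :
    (estHypXhD (ha := ha) (haB := haB) hM hIM hδ₀ hδ).p₁ = id := rfl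

/-- [folklore] -/
theorem estHypXhD_p₂ (hM : 0 < M) (hIM : I₀ + M < n) (hδ₀ : 0 < δ₀) (hδ : δ₀ ≤ 1 / 2) :
    (estHypXhD (ha := ha) (haB := haB) hM hIM hδ₀ hδ).p₂ = id := rfl

/-- [folklore] -/
theorem estHypXhD_bB₁ (hM : 0 < M) (hIM : I₀ + M < n) (hδ₀ : 0 < δ₀) (hδ : δ₀ ≤ 1 / 2) :
    (estHypXhD (ha := ha) (haB := haB) hM hIM hδ₀ hδ).bB₁ = id := rfl

/-- [folklore] -/
theorem estHypXhD_bB₂ (hM : 0 < M) (hIM : I₀ + M < n) (hδ₀ : 0 < δ₀) (hδ : δ₀ ≤ 1 / 2) :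
    (estHypXhD (ha := ha) (haB := haB) hM hIM hδ₀ hδ).bB₂ = id := rfl

/-- [folklore] -/
theorem estHypXhD_nonempty (hM : 0 < M) (hIM : I₀ + M < n) (hδ₀ : 0 < δ₀) (hδ : δ₀ ≤ 1 / 2) :
    Nonempty (EstHyp (toyFrameD n B (rampZone n M I₀) (rampZone_nonempty (lt_of_hIM hIM)) δ₀)
      (Xh n B M I₀ a ha haB) (Fin n × Fin B) (Fin n) (Fin n)) :=
  ⟨estHypXhD hM hIM hδ₀ hδ⟩

/-- **THEOREM D FOR THE SMOOTH-CUTOFF DATUM ON THE DECAYING FRAME** (headline): the cell's `EstHyp.dT_entry` on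
`estHypXhD` with every frame field unfolded —
`|𝔇(T)(I, J)| ≤ 22·θ_X·(3a⁴·1·Kg(δ₀/40))¹⁵·B²·exp(−(δ₀/4)·(|I−J| + β(I) + β(J)))`, `β = zoneDepth` to the ramp
zone `rampZone n M I₀`, `θ_X = thetaX M δ₀ = O(M⁻¹)`: a constant FREE of `n`, exponential decay in the block distance
and in the depths of both blocks.  Hypotheses: `2²⁰ ≤ a ≤ B`, `0 < M`, `I₀ + M < n`, `0 < δ₀ ≤ 1/2`.  OURS.
[folklore] -/
theorem XhD_dT_entry (hM : 0 < M) (hIM : I₀ + M < n) (hδ₀ : 0 < δ₀) (hδ : δ₀ ≤ 1 / 2) (I J : Fin n) :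
    |(Xh n B M I₀ a ha haB).dT I J| ≤
      22 * thetaX M δ₀ * (3 * a ^ 4 * 1 * Kg (δ₀ / 40)) ^ 15 * (B : ℝ) ^ (2 : ℤ) *
        Real.exp (-(δ₀ / 4 * (bdist n I J
          + zoneDepth (bdist n) (rampZone n M I₀) (rampZone_nonempty (lt_of_hIM hIM)) I
          + zoneDepth (bdist n) (rampZone n M I₀) (rampZone_nonempty (lt_of_hIM hIM)) J))) := by
  have h := (estHypXhD (ha := ha) (haB := haB) hM hIM hδ₀ hδ).dT_entry
    (toyFrameD_valid (hBpos_of ha haB) _ hδ₀) I J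
  rw [toyFrameD_σ, estHypXhD_c, estHypXhD_θ, estHypXhD_p₁, estHypXhD_p₂, estHypXhD_bB₁, estHypXhD_bB₂,
    toyFrameD_Λ, toyFrameD_K, toyFrameD_u, toyFrameD_sc, toyFrameD_ρ, toyFrameD_β] at h
  exact h

/-- **THE COMMUTATOR READING**: `|h₄(x_S I) − h₄(x_S J)|·|(Q′·Gtoy·Q′*)(I, J)| ≤ 22·θ_X·(3a⁴·Kg(δ₀/40))¹⁵·B²·
exp(−(δ₀/4)·(|I−J| + β(I) + β(J)))` — the commutator of the smooth block cutoff with the coarse minimal-propagator-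
type operator is `O(M⁻¹)`, localised on the ramp zone. OURS. [folklore] -/
theorem XhD_comm_entry (hM : 0 < M) (hIM : I₀ + M < n) (hδ₀ : 0 < δ₀) (hδ : δ₀ ≤ 1 / 2) (I J : Fin n) :
    |h4 n B M I₀ (xS (hBpos_of ha haB) I) - h4 n B M I₀ (xS (hBpos_of ha haB) J)| *
        |(Qp n B * Gtoy n B ((a / B) ^ 2) ((a / B) ^ 2) * Qpt n B) I J| ≤
      22 * thetaX M δ₀ * (3 * a ^ 4 * 1 * Kg (δ₀ / 40)) ^ 15 * (B : ℝ) ^ (2 : ℤ) *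
        Real.exp (-(δ₀ / 4 * (bdist n I J
          + zoneDepth (bdist n) (rampZone n M I₀) (rampZone_nonempty (lt_of_hIM hIM)) I
          + zoneDepth (bdist n) (rampZone n M I₀) (rampZone_nonempty (lt_of_hIM hIM)) J))) := by
  rw [← abs_mul, ← Xh_dT_apply (ha := ha) (haB := haB)]
  exact XhD_dT_entry hM hIM hδ₀ hδ I J

/-- the explicit constant: `(3a⁴·1·Kg(δ₀/40))¹⁵ ≤ (243a⁴/δ₀)¹⁵` for `0 < δ₀ ≤ 1/2` (Toy13's `Kg_u_le`).
[folklore] -/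
theorem const3_pow_le (hδ₀ : 0 < δ₀) (hδ : δ₀ ≤ 1 / 2) (a : ℝ) :
    (3 * a ^ 4 * 1 * Kg (δ₀ / 40)) ^ 15 ≤ (243 * a ^ 4 / δ₀) ^ 15 := by
  have hK0 : 0 ≤ Kg (δ₀ / 40) := Kg_nonneg (by linarith)
  have h0 : 0 ≤ 3 * a ^ 4 * 1 * Kg (δ₀ / 40) := by positivity
  refine pow_le_pow_left₀ h0 ?_ 15
  calc 3 * a ^ 4 * 1 * Kg (δ₀ / 40) ≤ 3 * a ^ 4 * 1 * (81 / δ₀) :=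
        mul_le_mul_of_nonneg_left (Kg_u_le hδ₀ hδ) (by positivity)
    _ = 243 * a ^ 4 / δ₀ := by ring

/-- **THE EXPLICIT FORM**: `|𝔇(T)(I, J)| ≤ 22·(48/M)·(243a⁴/δ₀)¹⁵·B²·exp(−(δ₀/4)·(|I−J| + β(I) + β(J)))` — the
`1/M` of the printed *"[Δ′, h] gives the factor O(M⁻¹)"*, times the cell's astronomical but volume-free constant.
OURS. [folklore] -/
theorem XhD_dT_entry_explicit (hM : 0 < M) (hIM : I₀ + M < n) (hδ₀ : 0 < δ₀) (hδ : δ₀ ≤ 1 / 2) (I J : Fin n) :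
    |(Xh n B M I₀ a ha haB).dT I J| ≤
      22 * (48 / M) * (243 * a ^ 4 / δ₀) ^ 15 * (B : ℝ) ^ (2 : ℤ) *
        Real.exp (-(δ₀ / 4 * (bdist n I J
          + zoneDepth (bdist n) (rampZone n M I₀) (rampZone_nonempty (lt_of_hIM hIM)) I
          + zoneDepth (bdist n) (rampZone n M I₀) (rampZone_nonempty (lt_of_hIM hIM)) J))) := by
  refine (XhD_dT_entry hM hIM hδ₀ hδ I J).trans ?_
  have hθ := thetaX_le (δ₀ := δ₀) hM (by linarith)
  have hθ0 : 0 ≤ thetaX M δ₀ := thetaX_nonneg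
  have hc := const3_pow_le hδ₀ hδ a
  have hc0 : 0 ≤ (3 * a ^ 4 * 1 * Kg (δ₀ / 40)) ^ 15 :=
    pow_nonneg (by have := Kg_nonneg (show 0 < δ₀ / 40 by linarith); positivity) 15
  have hB2 : 0 ≤ (B : ℝ) ^ (2 : ℤ) := zpow_nonneg (Nat.cast_nonneg B) 2
  have he := Real.exp_nonneg (-(δ₀ / 4 * (bdist n I J
          + zoneDepth (bdist n) (rampZone n M I₀) (rampZone_nonempty (lt_of_hIM hIM)) I
          + zoneDepth (bdist n) (rampZone n M I₀) (rampZone_nonempty (lt_of_hIM hIM)) J)))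
  have h1 : 22 * thetaX M δ₀ * (3 * a ^ 4 * 1 * Kg (δ₀ / 40)) ^ 15 ≤ 22 * (48 / M) * (243 * a ^ 4 / δ₀) ^ 15 :=
    mul_le_mul (mul_le_mul_of_nonneg_left hθ (by norm_num)) hc hc0 (by positivity)
  exact mul_le_mul_of_nonneg_right (mul_le_mul_of_nonneg_right h1 hB2) he

end EstD

end

end Literature.MathematicalPhysics.QuantumFieldTheory.Balaban1983to89.B9SectCDiffCutModelToy14
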